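import Summits.Schanuel.Schanuel.Theorems.DiophantineDichotomyApproximationPropertyDefs
import Summits.Schanuel.Schanuel.Theorems.DiophantineDichotomyApproximationPropertyOrbitClusterBound
import Summits.Schanuel.Schanuel.Theorems.DiophantineDichotomyApproximationPropertyCycleAPIOne
import Summits.Schanuel.Schanuel.Theorems.DiophantineDichotomyApproximationPropertyPointAP
import Summits.Schanuel.Schanuel.Theorems.DiophantineDichotomyApproximationPropertySharpClosestPoint
import Summits.Schanuel.Schanuel.Theorems.DiophantineDichotomyApproximationPropertyZeroDimDictionary
import Summits.Schanuel.Schanuel.Theorems.DiophantineDichotomyApproximationPropertyLift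

/-!
# The `t = 1` slice of the crux `ApproximationProperty` from line `orbit-interpolation-determinant` (second proof of stmt-Schanuel-11037)

Route `DiophantineDichotomy` (sub-problem `Schanuel/Schanuel`), support item stmt-Schanuel-11037
`Summit.Schanuel.Schanuel.Theses.DiophantineDichotomy.ApproximationPropertyDegOne`: every `θ ∈ ℂ^ι` (finite `ι`)
with `trdeg_ℚ ℚ(θ) ≤ 1` admits, for all `Y ≥ Δ ≥ c(θ)`, an algebraic approximation `γ` with `[ℚ(γ):ℚ] ≤ d ≤ cΔ`,
certificates of naive height `H` with `log H ≤ cY`, and `‖γ − θ‖ ≤ exp(−(log H·Δ + d·Y)/c)` — the theorem of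
Laurent–Roy (Ann. Inst. Fourier 49 (1999) Thm 1 + §§5–6, points of a curve) / Diaz 1997 (`m = 1`,
Bugeaud 2004 Thm 8.11), obtained here UNCONDITIONALLY (a second, independent proof: the item stmt-Schanuel-11037 was closed
earlier via Diaz's theorem + Roy–Waldschmidt lifting in `DiophantineDichotomyApproximationPropertyDegOne.lean`)
as the `t = 1` pay-off of the line
`orbit-interpolation-determinant` for the crux `ApproximationProperty` (stmt-Schanuel-6117): Dirichlet's box
principle in `ℙ¹` (`stub_cycleAPI_one`), the 0-dimensional dictionary (`stub_zeroDimDictionary`), the lever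
`OrbitClusterBound` and the transfer `SharpClosestPoint`, the pigeonhole `stub_pointAP` and the lifting
`stub_lift` — all kernel-checked in `Theorems/DiophantineDichotomyApproximationProperty*.lean` — composed by
`slice_one` below (pure logic, the `t = 1` case of the skeleton's `slice_of`) and the `Iff.rfl`-level glue
`degOne_of_slice_one` of the definitions module. No named fact is used.
-/

-- `Summit.Schanuel.Schanuel.…` is the mandated summit/sub-problem namespace (single-conjunct summit):
set_option linter.dupNamespace false

namespace Summit.Schanuel.Schanuel.Cruxes.ApproximationProperty.OrbitInterpolationDeterminant

/-- The `t = 1` slice of the crux from the landed stubs (the skeleton's `slice_one_of` with its hypotheses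
discharged): cycle input in ℙ¹ + dictionary + transfer + pigeonhole + lifting. -/
theorem slice_one : PointwiseAPSlice 1 :=
  stub_lift 1 le_rfl fun t₀ h₀ h₀1 => by
    obtain rfl : t₀ = 1 := le_antisymm h₀1 h₀
    exact stub_pointAP 1 le_rfl stub_zeroDimDictionary stub_cycleAPI_one
      (stub_sharpClosestPoint stub_orbitClusterBound stub_zeroDimDictionary)

end Summit.Schanuel.Schanuel.Cruxes.ApproximationProperty.OrbitInterpolationDeterminant

namespace Summit.Schanuel.Schanuel.Theorems

/-- **`ApproximationPropertyDegOne` from the line** (support item stmt-Schanuel-11037 of route DiophantineDichotomy, second proof):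
Philippon's approximation property in transcendence degree `1`, output-dependent affine form, all scales.
Laurent–Roy 1999 / Diaz 1997, proved here from the line `orbit-interpolation-determinant`. -/
theorem approximationPropertyDegOne_of_line :
    Summit.Schanuel.Schanuel.Theses.DiophantineDichotomy.ApproximationPropertyDegOne :=
  Summit.Schanuel.Schanuel.Cruxes.ApproximationProperty.OrbitInterpolationDeterminant.degOne_of_slice_one
    Summit.Schanuel.Schanuel.Cruxes.ApproximationProperty.OrbitInterpolationDeterminant.slice_one

end Summit.Schanuel.Schanuel.Theorems
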